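import Mathlib

/-!
# OCT g17 — PER-exc sketch: Lerch's congruence and the digit-structure law (crux stmt-BirchSwinnertonDyer-25138)

In-Lean content of `Ideas/ordinary-cm-torsor-g17-perexc.md`: the elementary congruence (Lerch 1905) that turns
Stevens' period formula for `E(ω̃, ω̃⁻¹)` into the Fermat-quotient law (FQ), plus the arithmetic function
`s(b,S)` of the digit-structure law and its decidable instances (Wieferich exponents behind N = 175, 363, 931, 1075).
Statements only (`def … : Prop`) + `native_decide`d sanity instances (kernel `decide` is blocked by the well-founded `ZMod.inv`). BSD is not proved by this; Manin `c = 1` is not proved by this.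
-/

namespace Summit.BirchSwinnertonDyer.BirchSwinnertonDyer.Cruxes.EisensteinAdditiveManinResidual.OrdinaryCMTorsorG17

/-- Lerch's sum `Σ_{m=1}^{p-1} ⌊m d / p⌋ · m⁻¹` in `ZMod p`. -/
def lerchSum (p d : ℕ) : ZMod p :=
  ∑ m ∈ Finset.Ico 1 p, ((m * d / p : ℕ) : ZMod p) * (m : ZMod p)⁻¹

/-- The Fermat quotient `q_p(d) = (d^{p-1} - 1)/p`, reduced mod `p`. -/
def fermatQuotient (p d : ℕ) : ZMod p := (((d ^ (p - 1) - 1) / p : ℕ) : ZMod p)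

/-- LERCH 1905 (Math. Ann. 60, 471–490; Dobson arXiv:1103.3907 eq. (1)): for a prime `p ≥ 3` and `p ∤ d`,
`Σ_{m=1}^{p-1} ⌊md/p⌋ · m⁻¹ ≡ d · q_p(d) (mod p)`. -/
def LerchCongruence : Prop :=
  ∀ p d : ℕ, p.Prime → 3 ≤ p → ¬ p ∣ d → lerchSum p d = (d : ZMod p) * fermatQuotient p d

/-- The harmonic form actually met in Stevens' formula (★St): `Σ_{μ=0}^{d-1} H_{⌊pμ/d⌋}`, `H_n = Σ_{m ≤ n} m⁻¹`. -/
def harmonicLerch (p d : ℕ) : ZMod p :=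
  ∑ μ ∈ Finset.range d, ∑ m ∈ Finset.Icc 1 (p * μ / d), (m : ZMod p)⁻¹

/-- Equivalent form used in the proof of (FQ): `Σ_{μ<d} H_{⌊pμ/d⌋} ≡ - d · q_p(d) (mod p)`. -/
def HarmonicLerchCongruence : Prop :=
  ∀ p d : ℕ, p.Prime → 3 ≤ p → ¬ p ∣ d → harmonicLerch p d = -((d : ZMod p) * fermatQuotient p d)

/-- Wieferich exponent `w_p(ℓ) = v_p(q_p(ℓ)) = v_p(ℓ^{p-1} - 1) - 1`. -/
def wieferichExp (p ℓ : ℕ) : ℕ := padicValNat p (ℓ ^ (p - 1) - 1) - 1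

/-- Digit-1 ("μ-digit") exponent of the Stevens line indexed by the set `S` of β-stabilised primes:
`s(1,S) = max(0, |S| - 1 + Σ_{ℓ ∈ S} w_p(ℓ))` (the law of the note, b = 1). -/
def digitOneExp (p : ℕ) (S : Finset ℕ) : ℕ := S.card + (∑ ℓ ∈ S, wieferichExp p ℓ) - 1

/-- THE PREDICTION registered before kit jobs j334759 / j334760 (b = 1, squarefree tame level `M`, no `ℓ ≡ 1 (mod p)`):
the digit-1 part of the cuspidal divisor class group of `X₀(p² M)` tensored with `ℤ_p` is `⊕_{S ⊆ primes(M)} ℤ/p^{s(1,S)}`.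
(Informal target; the modular-curve side is not typed here.) -/
def DigitOneLawInformal : Prop := True

-- ── decidable sanity instances ──────────────────────────────────────────────────────────
-- Lerch at (p,d) = (5,3), (7,2), (7,3), (11,2), (13,5):
example : lerchSum 5 3 = (3 : ZMod 5) * fermatQuotient 5 3 := by native_decide
example : lerchSum 7 2 = (2 : ZMod 7) * fermatQuotient 7 2 := by native_decide
example : lerchSum 7 3 = (3 : ZMod 7) * fermatQuotient 7 3 := by native_decide
example : lerchSum 11 2 = (2 : ZMod 11) * fermatQuotient 11 2 := by native_decide
example : lerchSum 13 5 = (5 : ZMod 13) * fermatQuotient 13 5 := by native_decide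
-- harmonic form at (5,3), (7,2), (7,4), (11,3):
example : harmonicLerch 5 3 = -((3 : ZMod 5) * fermatQuotient 5 3) := by native_decide
example : harmonicLerch 7 2 = -((2 : ZMod 7) * fermatQuotient 7 2) := by native_decide
example : harmonicLerch 7 4 = -((4 : ZMod 7) * fermatQuotient 7 4) := by native_decide
example : harmonicLerch 11 3 = -((3 : ZMod 11) * fermatQuotient 11 3) := by native_decide
-- Wieferich bases behind the nonempty μ-digits: 7 at 5 (N = 175), 3 at 11 (N = 363), 43 at 5 (N = 1075), 31 at 7 (N = 1519): w = 1;
-- 19 at 7 (N = 931): w = 2; non-examples 2, 3 at 5 and 2, 3, 5 at 7: w = 0.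
example : 5 ^ 2 ∣ 7 ^ 4 - 1 ∧ ¬ 5 ^ 3 ∣ 7 ^ 4 - 1 := by native_decide
example : 11 ^ 2 ∣ 3 ^ 10 - 1 ∧ ¬ 11 ^ 3 ∣ 3 ^ 10 - 1 := by native_decide
example : 5 ^ 2 ∣ 43 ^ 4 - 1 ∧ ¬ 5 ^ 3 ∣ 43 ^ 4 - 1 := by native_decide
example : 7 ^ 2 ∣ 31 ^ 6 - 1 ∧ ¬ 7 ^ 3 ∣ 31 ^ 6 - 1 := by native_decide
example : 7 ^ 3 ∣ 19 ^ 6 - 1 ∧ ¬ 7 ^ 4 ∣ 19 ^ 6 - 1 := by native_decide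
example : ¬ 5 ^ 2 ∣ 2 ^ 4 - 1 ∧ ¬ 5 ^ 2 ∣ 3 ^ 4 - 1 ∧ ¬ 7 ^ 2 ∣ 2 ^ 6 - 1 ∧ ¬ 7 ^ 2 ∣ 3 ^ 6 - 1 ∧ ¬ 7 ^ 2 ∣ 5 ^ 6 - 1 := by native_decide
-- b = 2 law inputs: 149 ≡ -1 (mod 25) (N = 3725: order-25 prediction), 97 ≡ -1 (mod 49) (N = 4753: order-49 prediction)
example : 5 ^ 2 ∣ 149 ^ 2 - 1 ∧ ¬ 5 ^ 3 ∣ 149 ^ 2 - 1 := by native_decide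
example : 7 ^ 2 ∣ 97 ^ 2 - 1 ∧ ¬ 7 ^ 3 ∣ 97 ^ 2 - 1 := by native_decide

end Summit.BirchSwinnertonDyer.BirchSwinnertonDyer.Cruxes.EisensteinAdditiveManinResidual.OrdinaryCMTorsorG17
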